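import Summits.ABC.ABC.Theses.CubicResolventAllowance
import Summits.ABC.ABC.Theorems.PlaceCountSzpiroDiscLeJHeight
import Literature.NumberTheory.EllipticCurves.SzpiroSmallJDenominatorProofs
import Literature.NumberTheory.EllipticCurves.PastenValuationProduct
import HarnessLib

/-!
# STUB-IDEAS `stub_realCubic` · ideator k1 · generation 5 — typed helper statements (rev 5)

Crux stmt-ABC-22740 `CubicResolventAllowance.IndexSzpiro`, stub `stub_realCubic` (the `0 < d_K` half),
route-ABC-CubicResolventAllowance. FAMILY 1 (recognise & import). Generation 5 adds, BY NAME, what the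
four earlier generations of the three `stub_realCubic` files did not cite:

* **§0 the cut is cosmetic.** `Stub` (verbatim) is the `0 < d_K` half of the sign-free statement
  `StubAllSigns`; `stub_of_allSigns` (PROVED). Every helper below — and every helper in the sibling file
  `StubIdeas1G4Sketch.lean` (`StubIdeasComplexCubic1G4`: T1 Shafarevich threshold absorption,
  B1″/P1 `den(j)`-windows with `Pasten2023_cor_2_1`, S1 Serre level `|d_K| ∣ 1944·N_E`) — is sign-free,
  hence serves `stub_realCubic` verbatim. No sign-specific Szpiro input exists in print (searched).
* **§1 the `j`-denominator sandwich is LANDED**: `den(j) ∣ Δ_min ∣ 2⁸·den(j)·N⁵`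
  (`Literature…den_j_dvd_natAbs_minimalDiscriminantInt`, `Summit…minimalDiscriminantNorm_dvd_den_j_mul`);
  real-cast form `minimalDiscriminantNorm_le_den_mul` (PROVED); on SEMISTABLE curves `den(j) = Δ_min`
  (`den_j_eq_minimalDiscriminantNorm_of_isSemistable`, PROVED prime by prime from
  `DiscLeJHeight.ordMinimalDiscriminant_le_den_of_hasMultiplicativeReductionAt`) so there the stub IS the `den(j)`-allowance
  (`ineq_iff_den_of_isSemistable`, PROVED); sharp global form with multiplicative primes exact
  (`radMult_pow_mul_minimalDiscriminantNorm_dvd`, statement, S).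
* **§2 Pasten 2023 Thm 1.2 as a rung in stub currency** (`rung_smallDenominator`, PROVED from the tree's
  `Pasten2023_thm_1_2`, itself proved in the tree from Cor 2.1 + Cor 3.4): `den(j) ≤ A (log num j)^B`,
  `B < 1 + ε` ⇒ the stub inequality — towers of unbounded depth allowed, complementary to the
  Mestre–Oesterlé prime-conductor rung (`n_p ≤ 5`) and to ideator 3's Rung A⁺ (bounded pole count).
* **§3 by-name per-place toolkit** (`#check`s): `DiscLeJHeight.localBound` and its four case lemmas are the
  Tate-algorithm accounting that ideator 2's T4/T5 table, ideator 3's `rungAPlus` and k1-rev-2 B1/B2 sorried.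
* **§4 examined, no teeth (negative knowledge, by name)**: `pasten_thm_1_12` (valuation PRODUCT — a
  violator may be ONE deep tower at a large prime), `PastenShimura2024_thm_18_14` (+ `DNS2020_theorem4`:
  `d_K > 0` ⟺ `K` totally real ⟹ `E/K` modular — but the output is exponential with `K`-dependent constants).

Nothing here proves the stub (verdict unchanged: even-tower Szpiro on the irreducible class, open).
Scratch namespace; not a tree proposal.
-/

set_option linter.dupNamespace false

noncomputable section

namespace Summit.ABC.ABC.Cruxes.IndexSzpiro.StubIdeasRealCubic1G5

open Polynomial
open scoped NumberField
open WeierstrassCurve Height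
open IsDedekindDomain Rat.HeightOneSpectrum
open Literature.NumberTheory.EllipticCurves Literature.NumberTheory.DiophantineGeometry

/-! ## §0 — the stub, and the sign-free statement it is half of -/

/-- The stub, verbatim (payload `stub.signature`). -/
def Stub : Prop :=
  ∀ ε : ℝ, 0 < ε → ∃ C : ℝ, ∀ (W : WeierstrassCurve ℚ) [W.IsElliptic] (K : Type) [Field K]
    [NumberField K], Irreducible W.twoTorsionPolynomial.toPoly → Module.finrank ℚ K = 3 →
    (∃ θ : K, aeval θ W.twoTorsionPolynomial.toPoly = 0) → 0 < NumberField.discr K →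
    (W.minimalDiscriminantNorm ℤ : ℝ) ≤
      C * |(NumberField.discr K : ℝ)| * (W.conductorNorm ℤ : ℝ) ^ (6 + ε)

/-- The sign-free statement (= the crux `IndexSzpiro` with `aeval` spelled as in the stubs): both
skeleton stubs at once. -/
def StubAllSigns : Prop :=
  ∀ ε : ℝ, 0 < ε → ∃ C : ℝ, ∀ (W : WeierstrassCurve ℚ) [W.IsElliptic] (K : Type) [Field K]
    [NumberField K], Irreducible W.twoTorsionPolynomial.toPoly → Module.finrank ℚ K = 3 →
    (∃ θ : K, aeval θ W.twoTorsionPolynomial.toPoly = 0) →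
    (W.minimalDiscriminantNorm ℤ : ℝ) ≤
      C * |(NumberField.discr K : ℝ)| * (W.conductorNorm ℤ : ℝ) ^ (6 + ε)

/-- The stub's inequality for one curve, one field, constants `(C, ε)`. -/
def Ineq (C ε : ℝ) (W : WeierstrassCurve ℚ) (K : Type) [Field K] [NumberField K] : Prop :=
  (W.minimalDiscriminantNorm ℤ : ℝ) ≤ C * |(NumberField.discr K : ℝ)| * (W.conductorNorm ℤ : ℝ) ^ (6 + ε)

/-- **§0 (PROVED).** The real stub is the `0 < d_K` half of the sign-free statement: any sign-free
helper closes it. (The skeleton's cut `real ∨ complex` is bookkeeping on `sign Δ_E = sign d_K`.) -/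
theorem stub_of_allSigns (h : StubAllSigns) : Stub := by
  intro ε hε
  obtain ⟨C, hC⟩ := h ε hε
  exact ⟨C, fun W _ K _ _ hirr h3 hθ _ => hC W K hirr h3 hθ⟩

/-- `1 ≤ |d_K|`. -/
theorem one_le_abs_discr (K : Type) [Field K] [NumberField K] :
    (1 : ℝ) ≤ |(NumberField.discr K : ℝ)| := by
  have h1 : (1 : ℤ) ≤ |NumberField.discr K| := Int.one_le_abs (NumberField.discr_ne_zero K)
  exact_mod_cast h1

/-! ## §1 — the `j`-denominator sandwich, by name -/

/-- **§1a (PROVED, by name).** `den(j_E) ∣ |Δ_min(E)|` (lower edge; tree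
`den_j_dvd_natAbs_minimalDiscriminantInt` + `minimalDiscriminantNorm_int_eq_natAbs_minimalDiscriminantInt_holds`).
Stated on a globally minimal model (both sides are model invariants; `hasGlobalMinimalModel_rat_holds`). -/
theorem den_j_dvd_minimalDiscriminantNorm (W : WeierstrassCurve ℚ) [W.IsElliptic] [W.IsGloballyMinimal] :
    (W.j).den ∣ W.minimalDiscriminantNorm ℤ := by
  rw [minimalDiscriminantNorm_int_eq_natAbs_minimalDiscriminantInt_holds W]
  exact den_j_dvd_natAbs_minimalDiscriminantInt W

/-- **§1b (PROVED, by name).** Real-cast upper edge `|Δ_min| ≤ 2⁸ · den(j) · N⁵`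
(tree `Summit.ABC.ABC.Theorems.minimalDiscriminantNorm_dvd_den_j_mul`). The glue every `den(j)`-window uses. -/
theorem minimalDiscriminantNorm_le_den_mul (W : WeierstrassCurve ℚ) [W.IsElliptic] :
    (W.minimalDiscriminantNorm ℤ : ℝ) ≤ 2 ^ 8 * ((W.j).den : ℝ) * (W.conductorNorm ℤ : ℝ) ^ (5 : ℕ) := by
  have hNpos : 0 < W.conductorNorm ℤ := conductorNorm_pos_holds W
  have hdvd := Summit.ABC.ABC.Theorems.minimalDiscriminantNorm_dvd_den_j_mul W
  have hpos : 0 < 2 ^ 8 * (W.j).den * (W.conductorNorm ℤ) ^ 5 :=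
    Nat.mul_pos (Nat.mul_pos (by norm_num) (W.j).den_pos) (pow_pos hNpos 5)
  exact_mod_cast Nat.le_of_dvd hpos hdvd

/-- **§1c (PROVED, from `DiscLeJHeight` by name).** On a SEMISTABLE curve (`f_v ≤ 1` at every place —
`W.IsSemistable ℤ` via the tree's `WeierstrassCurve.isSemistable_iff_conductorExponent_le_one_rat`) every bad
place is a tower, where `ord_v Δ_min ≤ ord_p den(j)`
(`DiscLeJHeight.ordMinimalDiscriminant_le_den_of_hasMultiplicativeReductionAt`,
`two_le_conductorExponent_of_not_hasMultiplicativeReductionAt`): `|Δ_min(E)| ∣ den(j_E)`.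
[cite: SilvermanAEC2009, Prop. VII.5.1(b)] -/
theorem minimalDiscriminantNorm_dvd_den_j_of_isSemistable (W : WeierstrassCurve ℚ) [W.IsElliptic]
    (hf : ∀ v : HeightOneSpectrum ℤ, W.conductorExponent v ≤ 1) :
    W.minimalDiscriminantNorm ℤ ∣ (W.j).den := by
  have hΔ0 : W.minimalDiscriminantNorm ℤ ≠ 0 := (minimalDiscriminantNorm_pos_holds W).ne'
  have hden0 : (W.j).den ≠ 0 := (W.j).den_pos.ne'
  rw [← Nat.factorization_prime_le_iff_dvd hΔ0 hden0]
  intro p hp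
  set v : HeightOneSpectrum ℤ := (primesEquiv (R := ℤ)).symm ⟨p, hp⟩ with hvdef
  have hv : natGenerator v = p :=
    congrArg Subtype.val ((primesEquiv (R := ℤ)).apply_symm_apply ⟨p, hp⟩)
  have hΔ : (W.minimalDiscriminantNorm ℤ).factorization p = W.ordMinimalDiscriminant v := by
    rw [← hv]; exact WeierstrassCurve.factorization_minimalDiscriminantNorm_holds W v
  rw [hΔ, ← hv]
  by_cases h0 : W.ordMinimalDiscriminant v = 0
  · rw [h0]; exact Nat.zero_le _
  by_cases hm : W.HasMultiplicativeReductionAt v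
  · exact Summit.ABC.ABC.Theorems.DiscLeJHeight.ordMinimalDiscriminant_le_den_of_hasMultiplicativeReductionAt
      W v hm
  · have h2 :=
      Summit.ABC.ABC.Theorems.DiscLeJHeight.two_le_conductorExponent_of_not_hasMultiplicativeReductionAt
        W v h0 hm
    have h1 := hf v
    omega

/-- **§1c′ (PROVED).** Hence on SEMISTABLE curves the `j`-currency is faithful: `den(j_E) = |Δ_min(E)|`
(§1a + §1c; Silverman 1986 §2: `𝔇 = Δ_{E/K}` for semistable `E/K`; the tree also has the ideal form
`Summit.ABC.ABC.Theorems.absNorm_jDenominatorIdeal_eq_of_isSemistable`). [cite: Silverman1986, §2 (p. 257)] -/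
theorem den_j_eq_minimalDiscriminantNorm_of_isSemistable (W : WeierstrassCurve ℚ) [W.IsElliptic]
    [W.IsGloballyMinimal] (hf : ∀ v : HeightOneSpectrum ℤ, W.conductorExponent v ≤ 1) :
    (W.j).den = W.minimalDiscriminantNorm ℤ :=
  Nat.dvd_antisymm (den_j_dvd_minimalDiscriminantNorm W) (minimalDiscriminantNorm_dvd_den_j_of_isSemistable W hf)

/-- **§1d (PROVED).** Hence on semistable class curves the stub inequality IS the `den(j)`-allowance
`den(j_E) ≤ C·|d_K|·N^{6+ε}` — the faithful `j`-currency form of ideator 3's even-tower residual. -/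
theorem ineq_iff_den_of_isSemistable (C ε : ℝ) (W : WeierstrassCurve ℚ) [W.IsElliptic]
    [W.IsGloballyMinimal] (hf : ∀ v : HeightOneSpectrum ℤ, W.conductorExponent v ≤ 1)
    (K : Type) [Field K] [NumberField K] :
    Ineq C ε W K ↔
      ((W.j).den : ℝ) ≤ C * |(NumberField.discr K : ℝ)| * (W.conductorNorm ℤ : ℝ) ^ (6 + ε) := by
  unfold Ineq
  rw [← den_j_eq_minimalDiscriminantNorm_of_isSemistable W hf]

/-- The product of the primes of multiplicative reduction (`f_p = 1`). -/
def radMult (W : WeierstrassCurve ℚ) [W.IsElliptic] : ℕ :=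
  ∏ p ∈ (W.conductorNorm ℤ).primeFactors.filter (fun p => (W.conductorNorm ℤ).factorization p = 1), p

/-- **§1e (S, statement; 1 cycle).** Sharp global form with multiplicative primes exact:
`radMult(E)⁵ · |Δ_min| ∣ 2⁸ · den(j) · N⁵` (at `f_p = 1`, `e_p = ord_p den(j)` by
`DiscLeJHeight.ordMinimalDiscriminant_le_den_of_hasMultiplicativeReductionAt`; elsewhere `localBound`;
same prime-by-prime proof as `minimalDiscriminantNorm_dvd_den_j_mul`). Removes the `p⁵` waste at towers. -/
theorem radMult_pow_mul_minimalDiscriminantNorm_dvd (W : WeierstrassCurve ℚ) [W.IsElliptic] :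
    radMult W ^ 5 * W.minimalDiscriminantNorm ℤ ∣ 2 ^ 8 * (W.j).den * W.conductorNorm ℤ ^ 5 := by
  sorry

/-! ## §2 — Pasten 2023 Thm 1.2 as a rung in stub currency -/

/-- **§2 (S, PROVED from the tree's `Pasten2023_thm_1_2`).** Small-denominator rung: for `0 < A`,
`0 < B < 1 + ε` there is `C` with `den(j_E) ≤ A (log num j_E)^B ⇒ Ineq C ε E K` for EVERY `K`
(`Δ ≤ A·16^{B+1} N^{B+5} (log N)^B`, `(log N)^B ≤ N^{1+ε-B}/τ^B`, `τ = (1+ε-B)/B`, `1 ≤ |d_K|`).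
`Pasten2023_thm_1_2` is proved in the tree from Cor 2.1 (`Pasten2023_cor_2_1_of_murtyPasten`,
`…_of_modularity_mazurKenku`) and Cor 3.4. [cite: Pasten2023SzpiroSmallDenominator, Thm. 1.2] -/
theorem rung_smallDenominator (h12 : Pasten2023_thm_1_2) {A B ε : ℝ} (hA : 0 < A) (hB : 0 < B)
    (hBε : B < 1 + ε) :
    ∃ C : ℝ, ∀ (W : WeierstrassCurve ℚ) [W.IsElliptic] (K : Type) [Field K] [NumberField K],
      ((W.j).den : ℝ) ≤ A * (Real.log ((W.j).num.natAbs : ℝ)) ^ B → Ineq C ε W K := by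
  set τ : ℝ := (1 + ε - B) / B with hτ
  have hτ0 : 0 < τ := div_pos (by linarith) hB
  refine ⟨A * 16 ^ (B + 1) / τ ^ B, ?_⟩
  intro W _ K _ _ hden
  unfold Ineq
  have hNpos : 0 < W.conductorNorm ℤ := conductorNorm_pos_holds W
  have hmain := h12 A B hA hB W hden
  set N : ℝ := (W.conductorNorm ℤ : ℝ) with hNdef
  have hN1 : (1 : ℝ) ≤ N := by rw [hNdef]; exact_mod_cast hNpos
  have hN0 : (0 : ℝ) < N := by linarith
  have hlogN : 0 ≤ Real.log N := Real.log_nonneg hN1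
  have hlog : Real.log N ≤ N ^ τ / τ := Real.log_le_rpow_div hN0.le hτ0
  have hτB : τ * B = 1 + ε - B := by rw [hτ]; field_simp
  have hpowB : (Real.log N) ^ B ≤ N ^ (1 + ε - B) / τ ^ B := by
    calc (Real.log N) ^ B ≤ (N ^ τ / τ) ^ B := Real.rpow_le_rpow hlogN hlog hB.le
      _ = (N ^ τ) ^ B / τ ^ B := Real.div_rpow (Real.rpow_nonneg hN0.le _) hτ0.le _
      _ = N ^ (1 + ε - B) / τ ^ B := by rw [← Real.rpow_mul hN0.le, hτB]
  have hdK := one_le_abs_discr K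
  have hexp : B + 5 + (1 + ε - B) = 6 + ε := by ring
  calc (W.minimalDiscriminantNorm ℤ : ℝ)
        ≤ A * 16 ^ (B + 1) * N ^ (B + 5) * (Real.log N) ^ B := hmain
    _ ≤ A * 16 ^ (B + 1) * N ^ (B + 5) * (N ^ (1 + ε - B) / τ ^ B) := by gcongr
    _ = A * 16 ^ (B + 1) / τ ^ B * (N ^ (B + 5) * N ^ (1 + ε - B)) := by ring
    _ = A * 16 ^ (B + 1) / τ ^ B * 1 * N ^ (6 + ε) := by rw [← Real.rpow_add hN0, hexp]; ring
    _ ≤ A * 16 ^ (B + 1) / τ ^ B * |(NumberField.discr K : ℝ)| * N ^ (6 + ε) := by gcongr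

/-! ## §3 — the per-place toolkit, by name (what earlier generations sorried as Tate-algorithm lemmas) -/

#check @Summit.ABC.ABC.Theorems.DiscLeJHeight.localBound
#check @Summit.ABC.ABC.Theorems.DiscLeJHeight.ordMinimalDiscriminant_le_den_of_hasMultiplicativeReductionAt
#check @Summit.ABC.ABC.Theorems.DiscLeJHeight.ordMinimalDiscriminant_le_conductorExponent_add_eight
#check @Summit.ABC.ABC.Theorems.DiscLeJHeight.ordMinimalDiscriminant_le_den_add_six
#check @Summit.ABC.ABC.Theorems.DiscLeJHeight.ordMinimalDiscriminant_le_eighteen_of_valuation_j_le_one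
#check @Summit.ABC.ABC.Theorems.DiscLeJHeight.ordMinimalDiscriminant_le_den_add_three_mul_two
#check @Summit.ABC.ABC.Theorems.log_minimalDiscriminantNorm_le_log_den_j

/-! ## §4 — examined, no teeth (recorded by name so nobody re-derives) -/

#check @Literature.NumberTheory.EllipticCurves.pasten_thm_1_12
#check @Literature.NumberTheory.EllipticCurves.shafarevich_minimalDiscriminantNorm_bounded
#check @Literature.NumberTheory.EllipticCurves.mestreOesterle_factorization_le_five
#check @Literature.NumberTheory.EllipticCurves.Pasten2023_thm_1_2_of_cor
#check @Literature.NumberTheory.EllipticCurves.Pasten2023_cor_2_1_of_murtyPasten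

end Summit.ABC.ABC.Cruxes.IndexSzpiro.StubIdeasRealCubic1G5

end
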